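import Summits.ValiantsHypothesis.ValiantsHypothesis.Theorems.SymPencilPerFourBlockPointCofactor

/-!
# Route `SymPencil` — leaf R1C of the `(11, 5, 4)` cascade: the POINT LEMMA (`--supports`
# stmt-ValiantsHypothesis-5674 `SdcSuperquadratic`; Theorems-side port / second proof of `stub_blockPoint33` of
# `Cruxes/SdcSuperquadratic/Lines/sing_five_classification.lean` rev 6, memo `SING-FIVE-CLASSIFICATION.md` §6.1)

* `fk_bool` — Frobenius–König for `3 × 3` zero patterns (no transversal ⇒ a zero row, a zero column, or a cross),
  Boolean form by `decide`;
* `blockPoint33` — **the point lemma of leaf R1C**, i.e. the workfile's `stub_blockPoint33` with `Sing3At` / `FamAt` /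
  `PointConcl` UNFOLDED: a matrix with zero row `3` and zero column `3`, all of whose `3 × 3` subpermanents vanish and
  which carries a per-direction family of four squares, has a second zero row, a second zero column, or cross support
  (`SymPencilPerFourBlockPointCofactor.transversals_eq_zero` + `fk_bool`).

Wiring for a 5674 crux-write hand: `theorem stub_blockPoint33 … := SymPencilPerFourBlockPointLemma.blockPoint33`.
Honest framing: [folklore]; second proof on the Theorems side of a leaf already proved inside the workfile (val-idea-18
g5 rev 7–8); leaf R1N and the cell file remain OPEN; `27 ≤ sdc(per₄) ≤ 29` unchanged; the crux `SdcSuperquadratic` and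
`VP ≠ VNP` untouched; no summit statement is proved here.  No definitions, no named facts.
-/

noncomputable section

set_option linter.dupNamespace false

namespace Summit.ValiantsHypothesis.ValiantsHypothesis.Theorems.SymPencilPerFourBlockPointLemma

open Matrix Module MvPolynomial
open Literature.Computability.AlgebraicComplexity
open Summit.ValiantsHypothesis.ValiantsHypothesis.Theorems.SymPencilPerFourBlockPointCofactor

variable {K : Type*} [Field K]

/-! ## 2. Frobenius–König for `3 × 3` support patterns -/

set_option maxRecDepth 8192 in
/-- **Frobenius–König, `3 × 3`, Boolean form**: a `0/1` pattern with no transversal misses a row, a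
column, or lies in a cross (row `l` ∪ column `c`). [folklore] -/
theorem fk_bool : ∀ S : Fin 3 → Fin 3 → Bool,
    (!(S 0 0 && S 1 1 && S 2 2) && !(S 0 0 && S 1 2 && S 2 1) && !(S 0 1 && S 1 0 && S 2 2) &&
      !(S 0 1 && S 1 2 && S 2 0) && !(S 0 2 && S 1 0 && S 2 1) && !(S 0 2 && S 1 1 && S 2 0)) = true →
    (!(S 0 0 || S 0 1 || S 0 2) || !(S 1 0 || S 1 1 || S 1 2) || !(S 2 0 || S 2 1 || S 2 2) ||
     !(S 0 0 || S 1 0 || S 2 0) || !(S 0 1 || S 1 1 || S 2 1) || !(S 0 2 || S 1 2 || S 2 2) ||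
     !(S 1 1 || S 1 2 || S 2 1 || S 2 2) || !(S 1 0 || S 1 2 || S 2 0 || S 2 2) || !(S 1 0 || S 1 1 || S 2 0 || S 2 1) ||
     !(S 0 1 || S 0 2 || S 2 1 || S 2 2) || !(S 0 0 || S 0 2 || S 2 0 || S 2 2) || !(S 0 0 || S 0 1 || S 2 0 || S 2 1) ||
     !(S 0 1 || S 0 2 || S 1 1 || S 1 2) || !(S 0 0 || S 0 2 || S 1 0 || S 1 2) || !(S 0 0 || S 0 1 || S 1 0 || S 1 1)) = true := by
  decide

/-! ## 3. The point lemma of leaf R1C -/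

/-- **Leaf R1C — POINT LEMMA** (`stub_blockPoint33` of `Cruxes/SdcSuperquadratic/Lines/sing_five_classification.lean`
rev 6, with `Sing3At` / `FamAt` / `PointConcl` UNFOLDED): a matrix `y` with zero row `3` and zero column `3`, all of
whose `3 × 3` subpermanents vanish and which carries a per-direction family of four squares, has a second zero row,
a second zero column, or cross support.  Proof: the six transversal products of the block vanish
(`transversals_eq_zero`), and Frobenius–König (`fk_bool`). [folklore] -/
theorem blockPoint33 [CharZero K] :
    ∀ y : Fin 4 × Fin 4 → K, (∀ m, y (3, m) = 0) → (∀ m, y (m, 3) = 0) →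
      (∀ (r c : Fin 3 → Fin 4), Function.Injective r → Function.Injective c →
        ((Matrix.of fun a b => y (a, b)).submatrix r c).permanent = 0) →
      (∃ (c : Fin 4 → K) (Λ : Fin 4 → ((Fin 4 × Fin 4 → K) →ₗ[K] K)),
        ∀ u : Fin 4 × Fin 4 → K, ∃ e₀ e₁ : K, ∀ s : K,
          eval (u + s • y) (perPoly (Fin 4) K) = e₀ + s * e₁ + s ^ 2 * ∑ k, c k * (Λ k u) ^ 2) →
      (∃ i', i' ≠ 3 ∧ ∀ m, y (i', m) = 0) ∨ (∃ j', j' ≠ 3 ∧ ∀ m, y (m, j') = 0) ∨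
        (∃ l c : Fin 4, ∀ a b : Fin 4, a ≠ l → b ≠ c → y (a, b) = 0) := by
  classical
  intro y hr hc hS hF
  obtain ⟨d1, d2, d3, d4, d5, d6⟩ := transversals_eq_zero y hr hc hS hF
  -- Boolean support pattern of the block
  let S : Fin 3 → Fin 3 → Bool :=
    ![![decide (y (0, 0) ≠ 0), decide (y (0, 1) ≠ 0), decide (y (0, 2) ≠ 0)],
      ![decide (y (1, 0) ≠ 0), decide (y (1, 1) ≠ 0), decide (y (1, 2) ≠ 0)],
      ![decide (y (2, 0) ≠ 0), decide (y (2, 1) ≠ 0), decide (y (2, 2) ≠ 0)]]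
  have hS00 : S 0 0 = decide (y (0, 0) ≠ 0) := rfl
  have hS01 : S 0 1 = decide (y (0, 1) ≠ 0) := rfl
  have hS02 : S 0 2 = decide (y (0, 2) ≠ 0) := rfl
  have hS10 : S 1 0 = decide (y (1, 0) ≠ 0) := rfl
  have hS11 : S 1 1 = decide (y (1, 1) ≠ 0) := rfl
  have hS12 : S 1 2 = decide (y (1, 2) ≠ 0) := rfl
  have hS20 : S 2 0 = decide (y (2, 0) ≠ 0) := rfl
  have hS21 : S 2 1 = decide (y (2, 1) ≠ 0) := rfl
  have hS22 : S 2 2 = decide (y (2, 2) ≠ 0) := rfl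
  -- a vanishing product kills the corresponding Boolean conjunction
  have tr : ∀ {p q r : K}, p * q * r = 0 →
      (decide (p ≠ 0) && decide (q ≠ 0) && decide (r ≠ 0)) = false := by
    intro p q r h
    rcases mul_eq_zero.1 h with h | h
    · rcases mul_eq_zero.1 h with h | h <;> simp [h]
    · simp [h]
  have H := fk_bool S (by
    rw [hS00, hS01, hS02, hS10, hS11, hS12, hS20, hS21, hS22, tr d1, tr d2, tr d3, tr d4, tr d5, tr d6]
    rfl)
  rw [hS00, hS01, hS02, hS10, hS11, hS12, hS20, hS21, hS22] at H
  simp only [Bool.or_eq_true, Bool.not_eq_true', Bool.or_eq_false_iff, decide_eq_false_iff_not, not_not,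
    or_assoc] at H
  -- read off the conclusion
  have row : ∀ i : Fin 4, i ≠ 3 → y (i, 0) = 0 → y (i, 1) = 0 → y (i, 2) = 0 →
      (∃ i', i' ≠ 3 ∧ ∀ m, y (i', m) = 0) := fun i hi h0 h1 h2 =>
    ⟨i, hi, fun m => by fin_cases m <;> first | exact h0 | exact h1 | exact h2 | exact hc _⟩
  have col : ∀ j : Fin 4, j ≠ 3 → y (0, j) = 0 → y (1, j) = 0 → y (2, j) = 0 →
      (∃ j', j' ≠ 3 ∧ ∀ m, y (m, j') = 0) := fun j hj h0 h1 h2 =>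
    ⟨j, hj, fun m => by fin_cases m <;> first | exact h0 | exact h1 | exact h2 | exact hr _⟩
  have cross : ∀ l c : Fin 4, l ≠ 3 → c ≠ 3 →
      (∀ a b : Fin 4, a ≠ l → a ≠ 3 → b ≠ c → b ≠ 3 → y (a, b) = 0) →
      (∃ l c : Fin 4, ∀ a b : Fin 4, a ≠ l → b ≠ c → y (a, b) = 0) := fun l c _ _ h =>
    ⟨l, c, fun a b ha hb => by
      by_cases ha3 : a = 3
      · rw [ha3]; exact hr b
      by_cases hb3 : b = 3
      · rw [hb3]; exact hc a
      exact h a b ha ha3 hb hb3⟩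
  rcases H with h | h | h | h | h | h | h | h | h | h | h | h | h | h | h
  · exact Or.inl (row 0 (by decide) h.1.1 h.1.2 h.2)
  · exact Or.inl (row 1 (by decide) h.1.1 h.1.2 h.2)
  · exact Or.inl (row 2 (by decide) h.1.1 h.1.2 h.2)
  · exact Or.inr (Or.inl (col 0 (by decide) h.1.1 h.1.2 h.2))
  · exact Or.inr (Or.inl (col 1 (by decide) h.1.1 h.1.2 h.2))
  · exact Or.inr (Or.inl (col 2 (by decide) h.1.1 h.1.2 h.2))
  all_goals
    obtain ⟨⟨⟨e1, e2⟩, e3⟩, e4⟩ := h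
    refine Or.inr (Or.inr ?_)
  · refine cross 0 0 (by decide) (by decide) fun a b ha ha3 hb hb3 => ?_
    fin_cases a <;> fin_cases b <;>
      first
        | exact (ha rfl).elim
        | exact (ha3 rfl).elim
        | exact (hb rfl).elim
        | exact (hb3 rfl).elim
        | exact e1
        | exact e2
        | exact e3
        | exact e4
  · refine cross 0 1 (by decide) (by decide) fun a b ha ha3 hb hb3 => ?_
    fin_cases a <;> fin_cases b <;>
      first
        | exact (ha rfl).elim
        | exact (ha3 rfl).elim
        | exact (hb rfl).elim
        | exact (hb3 rfl).elim
        | exact e1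
        | exact e2
        | exact e3
        | exact e4
  · refine cross 0 2 (by decide) (by decide) fun a b ha ha3 hb hb3 => ?_
    fin_cases a <;> fin_cases b <;>
      first
        | exact (ha rfl).elim
        | exact (ha3 rfl).elim
        | exact (hb rfl).elim
        | exact (hb3 rfl).elim
        | exact e1
        | exact e2
        | exact e3
        | exact e4
  · refine cross 1 0 (by decide) (by decide) fun a b ha ha3 hb hb3 => ?_
    fin_cases a <;> fin_cases b <;>
      first
        | exact (ha rfl).elim
        | exact (ha3 rfl).elim
        | exact (hb rfl).elim
        | exact (hb3 rfl).elim
        | exact e1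
        | exact e2
        | exact e3
        | exact e4
  · refine cross 1 1 (by decide) (by decide) fun a b ha ha3 hb hb3 => ?_
    fin_cases a <;> fin_cases b <;>
      first
        | exact (ha rfl).elim
        | exact (ha3 rfl).elim
        | exact (hb rfl).elim
        | exact (hb3 rfl).elim
        | exact e1
        | exact e2
        | exact e3
        | exact e4
  · refine cross 1 2 (by decide) (by decide) fun a b ha ha3 hb hb3 => ?_
    fin_cases a <;> fin_cases b <;>
      first
        | exact (ha rfl).elim
        | exact (ha3 rfl).elim
        | exact (hb rfl).elim
        | exact (hb3 rfl).elim
        | exact e1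
        | exact e2
        | exact e3
        | exact e4
  · refine cross 2 0 (by decide) (by decide) fun a b ha ha3 hb hb3 => ?_
    fin_cases a <;> fin_cases b <;>
      first
        | exact (ha rfl).elim
        | exact (ha3 rfl).elim
        | exact (hb rfl).elim
        | exact (hb3 rfl).elim
        | exact e1
        | exact e2
        | exact e3
        | exact e4
  · refine cross 2 1 (by decide) (by decide) fun a b ha ha3 hb hb3 => ?_
    fin_cases a <;> fin_cases b <;>
      first
        | exact (ha rfl).elim
        | exact (ha3 rfl).elim
        | exact (hb rfl).elim
        | exact (hb3 rfl).elim
        | exact e1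
        | exact e2
        | exact e3
        | exact e4
  · refine cross 2 2 (by decide) (by decide) fun a b ha ha3 hb hb3 => ?_
    fin_cases a <;> fin_cases b <;>
      first
        | exact (ha rfl).elim
        | exact (ha3 rfl).elim
        | exact (hb rfl).elim
        | exact (hb3 rfl).elim
        | exact e1
        | exact e2
        | exact e3
        | exact e4

end Summit.ValiantsHypothesis.ValiantsHypothesis.Theorems.SymPencilPerFourBlockPointLemma

end
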